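import Literature.Computability.AlgebraicComplexity.AlperBogartVelascoBoxFour
import HarnessLib

/-!
# Route `SymPencil` — the BoxFour equality case, II: a detecting pair of rows forces two zero rows
# (`--supports` stmt-ValiantsHypothesis-5674 `SdcSuperquadratic`; rung `sdc(per_4) ≥ 21`)

Let `W` be an `8`-dimensional space of `4 × 4` matrices (over a field of characteristic `0`) on
which all `3 × 3` subpermanents vanish, and suppose the pair of rows `p ≠ q` DETECTS `W`: an
element of `W` whose rows `p` and `q` vanish is zero.  Then `W → (row p, row q)` is a bijection
onto `K⁴ × K⁴` (dimension `8`), and every other row `a` of `W` vanishes identically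
(`rows_eq_zero_of_detecting_pair`): `W` is the space of matrices supported in the rows `p, q`.

Proof.  Write `B_q = {x ∈ W : row_q x = 0}` (`row_p : B_q ≅ K⁴`) and `B_p` likewise.  For `x ∈ B_q`,
`x' ∈ B_p` the cubic on the rows `(p, q, a)` of `x ± x'` gives `T_c(row_p x, row_q x', row_a x) = 0`;
as `row_q x'` is arbitrary, every pairing `y_l w_{l'} + y_{l'} w_l` of `y = row_p x`, `w = row_a x`
vanishes.  On the basis `x_l ∈ B_q` with `row_p x_l = e_l` this gives `row_a x_l = c_l e_l`, and on
`x_l + x_{l'}` it gives `c_l + c_{l'} = 0`, so `c = 0` (characteristic `≠ 2`): `row_a` kills `B_q`,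
similarly `B_p`, and `W = B_q + B_p`. [folklore]
-/

noncomputable section

-- single-conjunct layout: Sub = Summit, duplicated namespace component intended
set_option linter.dupNamespace false

namespace Summit.ValiantsHypothesis.ValiantsHypothesis.Theorems.SymPencilBoxFourGraph

open Module Finset
open Literature.Computability.AlgebraicComplexity
open Literature.Computability.AlgebraicComplexity.AlperBogartVelasco

variable {K : Type*} [Field K]

/-- **A detecting pair of rows forces the other two rows to vanish.**  See the module
docstring. [folklore] -/
theorem rows_eq_zero_of_detecting_pair [CharZero K] (W : Submodule K (Fin 4 × Fin 4 → K))
    (hW : ∀ x ∈ W, ∀ (r c : Fin 3 → Fin 4), Function.Injective r → Function.Injective c →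
      ((Matrix.of fun i j => x (i, j)).submatrix r c).permanent = 0)
    (h8 : finrank K W = 8) {p q : Fin 4} (hpq : p ≠ q)
    (hG : ∀ x ∈ W, (∀ j, x (p, j) = 0) → (∀ j, x (q, j) = 0) → x = 0) :
    ∀ x ∈ W, ∀ a : Fin 4, a ≠ p → a ≠ q → ∀ j, x (a, j) = 0 := by
  have hcases : ∀ i : Fin 4, i = 0 ∨ i = 1 ∨ i = 2 ∨ i = 3 := by decide
  have e00 : (0 : Fin 4).succAbove 0 = 1 := by decide
  have e01 : (0 : Fin 4).succAbove 1 = 2 := by decide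
  have e02 : (0 : Fin 4).succAbove 2 = 3 := by decide
  have e10 : (1 : Fin 4).succAbove 0 = 0 := by decide
  have e11 : (1 : Fin 4).succAbove 1 = 2 := by decide
  have e12 : (1 : Fin 4).succAbove 2 = 3 := by decide
  have e30 : (3 : Fin 4).succAbove 0 = 0 := by decide
  have e31 : (3 : Fin 4).succAbove 1 = 1 := by decide
  have e32 : (3 : Fin 4).succAbove 2 = 2 := by decide
  -- the trilinear forms
  let T : Fin 4 → (Fin 4 → K) → (Fin 4 → K) → (Fin 4 → K) → K := fun c u v w =>
    u (c.succAbove 0) * (v (c.succAbove 1) * w (c.succAbove 2) + v (c.succAbove 2) * w (c.succAbove 1)) +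
    u (c.succAbove 1) * (v (c.succAbove 0) * w (c.succAbove 2) + v (c.succAbove 2) * w (c.succAbove 0)) +
    u (c.succAbove 2) * (v (c.succAbove 0) * w (c.succAbove 1) + v (c.succAbove 1) * w (c.succAbove 0))
  have hI3 : ∀ c u v w, T c v u w = 0 → T c u v w = 0 := fun c u v w h => by
    simp only [T] at h ⊢; linear_combination h
  -- rows as linear maps
  let ρ : Fin 4 → (Fin 4 × Fin 4 → K) →ₗ[K] (Fin 4 → K) :=
    fun r => LinearMap.funLeft K K fun j => (r, j)
  have hρ : ∀ r x j, ρ r x j = x (r, j) := fun _ _ _ => rfl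
  have hρ0 : ∀ r x, ρ r x = 0 ↔ ∀ j, x (r, j) = 0 := fun r x =>
    ⟨fun h j => by rw [← hρ r x j, h, Pi.zero_apply], fun h => funext h⟩
  -- the cubics vanishing on `W`
  have hF : ∀ y ∈ W, ∀ r₀ r₁ r₂ : Fin 4, r₀ ≠ r₁ → r₀ ≠ r₂ → r₁ ≠ r₂ → ∀ c : Fin 4,
      T c (ρ r₀ y) (ρ r₁ y) (ρ r₂ y) = 0 := by
    intro y hy r₀ r₁ r₂ h01 h02 h12 c
    have hinj : Function.Injective ![r₀, r₁, r₂] := by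
      intro a b hab
      fin_cases a <;> fin_cases b <;> simp_all
    have h := hW y hy ![r₀, r₁, r₂] c.succAbove hinj Fin.succAbove_right_injective
    rw [Matrix.permanent_fin_three_row] at h
    simp only [Matrix.submatrix_apply, Matrix.of_apply, Matrix.cons_val_zero, Matrix.cons_val_one,
      Matrix.cons_val] at h
    simp only [T, hρ]
    linear_combination h
  -- from the vanishing of `T_c(y, t, w)` for all `t`: all pairings of `y` and `w` vanish
  have pairing : ∀ (y w : Fin 4 → K), (∀ (t : Fin 4 → K) (c : Fin 4), T c y t w = 0) →
      ∀ l l' : Fin 4, l ≠ l' → y l * w l' + y l' * w l = 0 := by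
    intro y w h l l' hll'
    have t01 := h (Pi.single 2 1) 3
    have t02 := h (Pi.single 1 1) 3
    have t12 := h (Pi.single 0 1) 3
    have t13 := h (Pi.single 2 1) 0
    have t23 := h (Pi.single 1 1) 0
    have t03 := h (Pi.single 2 1) 1
    simp only [T, e00, e01, e02, e10, e11, e12, e30, e31, e32,
      Pi.single_apply] at t01 t02 t12 t13 t23 t03
    simp only [show ((0 : Fin 4) = 2) = False by decide, show ((1 : Fin 4) = 2) = False by decide,
      show ((3 : Fin 4) = 2) = False by decide, show ((0 : Fin 4) = 1) = False by decide,
      show ((2 : Fin 4) = 1) = False by decide, show ((3 : Fin 4) = 1) = False by decide,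
      show ((1 : Fin 4) = 0) = False by decide, show ((2 : Fin 4) = 0) = False by decide,
      if_true, if_false, mul_zero, zero_mul, add_zero, zero_add] at t01 t02 t12 t13 t23 t03
    rcases hcases l with rfl | rfl | rfl | rfl <;> rcases hcases l' with rfl | rfl | rfl | rfl <;>
      first
      | exact absurd rfl hll'
      | linear_combination t01
      | linear_combination t02
      | linear_combination t12
      | linear_combination t13
      | linear_combination t23
      | linear_combination t03
  -- a detecting pair `(p', q')`: `row p'` is a bijection `{x ∈ W : row q' = 0} → K⁴`
  have hsurj : ∀ p' q' : Fin 4, (∀ x ∈ W, ρ p' x = 0 → ρ q' x = 0 → x = 0) →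
      ∀ y : Fin 4 → K, ∃ x ∈ W, ρ q' x = 0 ∧ ρ p' x = y := by
    intro p' q' hG' y
    let B : Submodule K (Fin 4 × Fin 4 → K) := W ⊓ LinearMap.ker (ρ q')
    let f : B →ₗ[K] (Fin 4 → K) := (ρ p').domRestrict B
    have hfinj : Function.Injective f := by
      refine LinearMap.ker_eq_bot.1 (LinearMap.ker_eq_bot'.2 fun x hx => ?_)
      have hxB : (x : Fin 4 × Fin 4 → K) ∈ B := x.2
      rw [Submodule.mem_inf, LinearMap.mem_ker] at hxB
      exact Subtype.ext (hG' x hxB.1 hx hxB.2)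
    have hB4 : 4 ≤ finrank K B := by
      have h1 := finrank_eq_finrank_map_add_finrank_inf_ker W (ρ q')
      have h2 : finrank K (W.map (ρ q')) ≤ 4 :=
        ((W.map (ρ q')).finrank_le).trans (by rw [finrank_fintype_fun_eq_card, Fintype.card_fin])
      change finrank K W = finrank K (W.map (ρ q')) + finrank K B at h1
      omega
    have hrange : LinearMap.range f = ⊤ := by
      apply Submodule.eq_top_of_finrank_eq
      rw [LinearMap.finrank_range_of_inj hfinj, finrank_fintype_fun_eq_card, Fintype.card_fin]
      have := B.finrank_le
      rw [finrank_fintype_fun_eq_card, Fintype.card_prod, Fintype.card_fin] at this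
      have h3 : finrank K B ≤ 4 := by
        have := LinearMap.finrank_range_of_inj hfinj
        have h4 := (LinearMap.range f).finrank_le
        rw [finrank_fintype_fun_eq_card, Fintype.card_fin] at h4
        omega
      omega
    have hy : y ∈ LinearMap.range f := by rw [hrange]; exact Submodule.mem_top
    obtain ⟨⟨x, hxB⟩, hx⟩ := hy
    rw [Submodule.mem_inf, LinearMap.mem_ker] at hxB
    exact ⟨x, hxB.1, hxB.2, hx⟩
  have hGpq : ∀ x ∈ W, ρ p x = 0 → ρ q x = 0 → x = 0 := fun x hx hp' hq' =>
    hG x hx ((hρ0 p x).1 hp') ((hρ0 q x).1 hq')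
  have hGqp : ∀ x ∈ W, ρ q x = 0 → ρ p x = 0 → x = 0 := fun x hx hq' hp' =>
    hG x hx ((hρ0 p x).1 hp') ((hρ0 q x).1 hq')
  intro x₀ hx₀ a hap haq
  -- the key identity on `B_q × B_p`
  have hkey : ∀ x ∈ W, ρ q x = 0 → ∀ x' ∈ W, ρ p x' = 0 → ∀ c,
      T c (ρ p x) (ρ q x') (ρ a x) = 0 ∧ T c (ρ p x) (ρ q x') (ρ a x') = 0 := by
    intro x hx hxq x' hx' hx'p c
    have h1 := hF (x + x') (W.add_mem hx hx') p q a hpq (Ne.symm hap) (Ne.symm haq) c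
    have h2 := hF (x - x') (W.sub_mem hx hx') p q a hpq (Ne.symm hap) (Ne.symm haq) c
    rw [map_add, map_add, map_add, hxq, hx'p, zero_add, add_zero] at h1
    rw [map_sub, map_sub, map_sub, hxq, hx'p, zero_sub, sub_zero] at h2
    have hA : (2 : K) * T c (ρ p x) (ρ q x') (ρ a x) = 0 := by
      simp only [T, Pi.add_apply, Pi.sub_apply, Pi.neg_apply] at h1 h2 ⊢
      linear_combination h1 - h2
    have hB : (2 : K) * T c (ρ p x) (ρ q x') (ρ a x') = 0 := by
      simp only [T, Pi.add_apply, Pi.sub_apply, Pi.neg_apply] at h1 h2 ⊢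
      linear_combination h1 + h2
    exact ⟨(mul_eq_zero.1 hA).resolve_left two_ne_zero,
      (mul_eq_zero.1 hB).resolve_left two_ne_zero⟩
  -- `row a` kills `{x ∈ W : row q' x = 0}` whenever `(p', q')` detects and the pairings vanish
  have hvan : ∀ p' q' : Fin 4, (∀ x ∈ W, ρ p' x = 0 → ρ q' x = 0 → x = 0) →
      (∀ x ∈ W, ρ q' x = 0 → ∀ (t : Fin 4 → K) (c : Fin 4), T c (ρ p' x) t (ρ a x) = 0) →
      ∀ x ∈ W, ρ q' x = 0 → ρ a x = 0 := by
    intro p' q' hG' hT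
    -- a basis `xb l` of `B_{q'}` with `row p' (xb l) = e_l`
    have hex : ∀ l : Fin 4, ∃ x ∈ W, ρ q' x = 0 ∧ ρ p' x = Pi.single l 1 :=
      fun l => hsurj p' q' hG' (Pi.single l 1)
    choose xb hxbW hxbq hxbp using hex
    -- `row a (xb l)` is supported at `l`
    have hoff : ∀ l m : Fin 4, m ≠ l → ρ a (xb l) m = 0 := by
      intro l m hml
      have h := pairing (ρ p' (xb l)) (ρ a (xb l)) (hT (xb l) (hxbW l) (hxbq l)) l m hml.symm
      rw [hxbp l, Pi.single_eq_same, Pi.single_eq_of_ne hml, one_mul, zero_mul, add_zero] at h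
      exact h
    -- the diagonal entries pair off
    have hdiag : ∀ l l' : Fin 4, l ≠ l' → ρ a (xb l) l + ρ a (xb l') l' = 0 := by
      intro l l' hll'
      have hxW := W.add_mem (hxbW l) (hxbW l')
      have hxq : ρ q' (xb l + xb l') = 0 := by rw [map_add, hxbq, hxbq, add_zero]
      have h := pairing (ρ p' (xb l + xb l')) (ρ a (xb l + xb l')) (hT _ hxW hxq) l l' hll'
      rw [map_add, map_add, hxbp, hxbp, Pi.add_apply, Pi.add_apply, Pi.add_apply, Pi.add_apply,
        Pi.single_eq_same, Pi.single_eq_same, Pi.single_eq_of_ne hll', Pi.single_eq_of_ne hll'.symm,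
        hoff l l' hll'.symm, hoff l' l hll'] at h
      linear_combination h
    have hdiag0 : ∀ l : Fin 4, ρ a (xb l) l = 0 := by
      have d01 := hdiag 0 1 (by decide)
      have d02 := hdiag 0 2 (by decide)
      have d12 := hdiag 1 2 (by decide)
      have d03 := hdiag 0 3 (by decide)
      have h0 : (2 : K) * ρ a (xb 0) 0 = 0 := by linear_combination d01 + d02 - d12
      have h0' : ρ a (xb 0) 0 = 0 := (mul_eq_zero.1 h0).resolve_left two_ne_zero
      intro l
      rcases hcases l with rfl | rfl | rfl | rfl
      · exact h0'
      · linear_combination d01 - h0'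
      · linear_combination d02 - h0'
      · linear_combination d03 - h0'
    have hxb0 : ∀ l, ρ a (xb l) = 0 := by
      intro l
      funext m
      by_cases hml : m = l
      · rw [hml]; exact hdiag0 l
      · exact hoff l m hml
    -- expand an arbitrary element of `B_{q'}` in the basis
    intro x hx hxq
    have hdec : x = ∑ l, ρ p' x l • xb l := by
      have hd : x - ∑ l, ρ p' x l • xb l = 0 := by
        apply hG' _ (W.sub_mem hx (W.sum_mem fun l _ => W.smul_mem _ (hxbW l)))
        · rw [map_sub, map_sum]
          simp only [map_smul, hxbp]
          ext m
          rw [Pi.sub_apply, Finset.sum_apply, Pi.zero_apply]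
          simp only [Pi.smul_apply, Pi.single_apply, smul_eq_mul, mul_ite, mul_one, mul_zero,
            Finset.sum_ite_eq, Finset.mem_univ, if_true, sub_self]
        · rw [map_sub, map_sum, hxq, zero_sub, neg_eq_zero]
          simp only [map_smul, hxbq, smul_zero, Finset.sum_const_zero]
      exact (sub_eq_zero.1 hd)
    rw [hdec, map_sum]
    simp only [map_smul, hxb0, smul_zero, Finset.sum_const_zero]
  -- apply it to `B_q` (free vector = `row q` of `B_p`) and to `B_p`
  have hvan_q : ∀ x ∈ W, ρ q x = 0 → ρ a x = 0 := by
    refine hvan p q hGpq fun x hx hxq t c => ?_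
    obtain ⟨x', hx'W, hx'p, hx'q⟩ := hsurj q p hGqp t
    have h := (hkey x hx hxq x' hx'W hx'p c).1
    rwa [hx'q] at h
  have hvan_p : ∀ x ∈ W, ρ p x = 0 → ρ a x = 0 := by
    refine hvan q p hGqp fun x' hx' hx'p t c => ?_
    obtain ⟨x, hxW, hxq, hxp⟩ := hsurj p q hGpq t
    have h := (hkey x hxW hxq x' hx' hx'p c).2
    rw [hxp] at h
    exact hI3 c _ _ _ h
  -- `W = B_q + B_p`
  obtain ⟨x₁, hx₁W, hx₁q, hx₁p⟩ := hsurj p q hGpq (ρ p x₀)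
  have h2 : ρ a (x₀ - x₁) = 0 :=
    hvan_p (x₀ - x₁) (W.sub_mem hx₀ hx₁W) (by rw [map_sub, hx₁p, sub_self])
  have h1 : ρ a x₁ = 0 := hvan_q x₁ hx₁W hx₁q
  rw [map_sub, h1, sub_zero] at h2
  exact (hρ0 a x₀).1 h2

end Summit.ValiantsHypothesis.ValiantsHypothesis.Theorems.SymPencilBoxFourGraph

end
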